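import Summits.CriticalPhenomena.PercolationContinuityZ3.Theorems.PercNearOneGluingNoHeavyLowerTailKNGoodGMgcCert
import HarnessLib

/-!
# THEOREM B certificates — the bilinear condition (B1a) for `j = 1` (designee = core-bottom relay), all three pocket references `r`
# (`NoHeavyLowerTail` cell, stmt-CriticalPhenomena-4575; prover `prim-hp-2`, gen 17)

Support file (`--supports stmt-CriticalPhenomena-4575`, COMPUTATIONAL: three `native_decide` evaluations of `KNGoodGMgc.checkBil 1 r`,
≈ 1.7·10⁷ integer operations / ≈ 30 s each in the interpreter).  No definitions, no named facts, no sorries.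
(B1a) of memo MEMO-gen15 §3d, multiplied out: `Φ_β(1;r)·Q₁₂ + Φ_ε(1;r)·Q_d ≥ 0` on `[0,1]¹²`, where `Φ_v(1;r)` is the `v`-coefficient of the
goodness target of `K/B` at designee position `1` with pocket reference `r` and `Q_π` the world law of `K`'s side (all as Bernoulli expectations
`KNGoodGMgc.bexp` of the explicit configuration functions `phiHat`, `qHat`).  The same nine inequalities were certified off-line by two
independent exact implementations (seat gen 15 `symtarget.py`/`bern.py`: 126 pure pieces; ttrl `hp2b/THMB-BERNSTEIN.md`); here the kernel
(via the compiler) evaluates the single 12-variable scaled-Bernstein tensor of `…KNGoodGMgcCert`.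
-/

namespace Summit.CriticalPhenomena.PercolationContinuityZ3.Theorems

namespace KNGoodGMgc

/-- (B1a), `r = 1`: the scaled-Bernstein check passes (COMPUTATIONAL, `native_decide`). [this work] -/
theorem checkBil_1_1 : checkBil 1 1 = true := by native_decide

/-- (B1a), `r = 2`: the scaled-Bernstein check passes (COMPUTATIONAL, `native_decide`). [this work] -/
theorem checkBil_1_2 : checkBil 1 2 = true := by native_decide

/-- (B1a), `r = 3`: the scaled-Bernstein check passes (COMPUTATIONAL, `native_decide`). [this work] -/
theorem checkBil_1_3 : checkBil 1 3 = true := by native_decide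

/-- **(B1a) of THEOREM B** for every pocket reference `r ∈ {1,2,3}`: `0 ≤ Φ_β(1;r)·Q₁₂ + Φ_ε(1;r)·Q_d` for all twelve side parameters in
`[0,1]` (memo MEMO-gen15 §3d/§3g). [this work] -/
theorem bil_1 (r : ℕ) (hr : r = 1 ∨ r = 2 ∨ r = 3) (x : ℕ → ℝ) (hx : ∀ i, 0 ≤ x i ∧ x i ≤ 1) :
    0 ≤ bexp 11 (fun c => phiHat 1 r c 1) x * bexp 12 (qHat [3]) x + bexp 11 (fun c => phiHat 1 r c 4) x * bexp 12 (qHat [0]) x := by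
  rcases hr with rfl | rfl | rfl
  · exact bil_of_check 1 1 checkBil_1_1 x hx
  · exact bil_of_check 1 2 checkBil_1_2 x hx
  · exact bil_of_check 1 3 checkBil_1_3 x hx

end KNGoodGMgc

end Summit.CriticalPhenomena.PercolationContinuityZ3.Theorems
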